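import Mathlib
import Summits.KontsevichZagierPeriods.KontsevichZagierPeriods.Theses.InverseLandau
import Summits.KontsevichZagierPeriods.KontsevichZagierPeriods.Theorems.InverseLandauTateFamilyKernelOpenCube
import Summits.KontsevichZagierPeriods.KontsevichZagierPeriods.Theorems.InverseLandauTateFamilyKernelRationalCertificate
import Summits.KontsevichZagierPeriods.KontsevichZagierPeriods.Theorems.InverseLandauTateFamilyKernelStubDimZero
import Summits.KontsevichZagierPeriods.KontsevichZagierPeriods.Theorems.InverseLandauTateFamilyKernelStubAssembly
import Summits.KontsevichZagierPeriods.KontsevichZagierPeriods.Theorems.InverseLandauTateFamilyKernelStubGlueProduct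
import Summits.KontsevichZagierPeriods.KontsevichZagierPeriods.Theorems.InverseLandauTateFamilyKernelStubFaceIntegral
import Summits.KontsevichZagierPeriods.KontsevichZagierPeriods.Theorems.InverseLandauTateFamilyKernelStubHyperoctahedral
import Summits.KontsevichZagierPeriods.KontsevichZagierPeriods.Theorems.InverseLandauTateFamilyKernelStubBoundaryFamilyLocal
import Summits.KontsevichZagierPeriods.KontsevichZagierPeriods.Theorems.InverseLandauTateFamilyKernelStubExactDescentLocal
import Summits.KontsevichZagierPeriods.KontsevichZagierPeriods.Theorems.InverseLandauTateFamilyKernelStubExactDescent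
import Summits.KontsevichZagierPeriods.KontsevichZagierPeriods.Theorems.InverseLandauTateFamilyKernelStubExactFibreTwo
import Summits.KontsevichZagierPeriods.KontsevichZagierPeriods.Theorems.InverseLandauTateFamilyKernelCovInstance
import Summits.KontsevichZagierPeriods.KontsevichZagierPeriods.Theorems.InverseLandauTateFamilyKernelIsotopyTwo
import Summits.KontsevichZagierPeriods.KontsevichZagierPeriods.Theorems.InverseLandauTateFamilyKernelIndepClass
import Summits.KontsevichZagierPeriods.KontsevichZagierPeriods.Theorems.InverseLandauTateFamilyKernelLoopInstance
import Summits.KontsevichZagierPeriods.KontsevichZagierPeriods.Theorems.InverseLandauTateFamilyKernelCurves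

/-!
# Crux `TateFamilyKernel` (stmt-KontsevichZagierPeriods-9130) — line `Sketch`, skeleton v12 (lead c4; v7 format of lead c3):
# induction on the dimension for TATE families on `(0,b)`; research stub = TATE DESCENT NORMAL
# FORM at the fibre (Ayoub elements WITH auxiliary cube variables + hyperoctahedral symmetry +
# products of lower TATE vanishing families)

`TateFamilyKernel_of : …Theses.InverseLandau.TateFamilyKernel` is the case `b = ε` of
`tameFibreKernel_tate_all`: for EVERY `D`, all `ℚ`-polynomials `P, Q` in `(z, ϖ)` with `Q` TATE
(`Q(z,0) ≡ c₀ ≠ 0`), `Q ≠ 0` on `[0,1]^D × (0,b)` and `∫_{(0,1)^D} P/Q(z,ϖ) dz = 0` for all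
`ϖ ∈ (0,b)`, and every real-algebraic `ϖ₀ ∈ (0,b)`, every tame cube representation of the fibre
`P/Q(·,ϖ₀)` is a relation. Strong induction on `D`:

* `D = 0` — `dimZero_local`; `D = 1` — `curves_local` (Baker at the fibre: `algCoeffKernelDimOne`,
  item 9132 PROVED); neither uses the Tate condition;
* `D = N + 2` — `stub_descentTate` (RESEARCH): at the fibre `ϖ₀` and on a bigger cube
  `[0,1]^{N+2+m}`, the integrand is a finite sum of
  (a) Ayoub elements `∂_{i_k}(A_k/D_k) − (A_k/D_k)|_{w_{i_k}=1} + (A_k/D_k)|_{w_{i_k}=0}` with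
      `ℚ`-polynomial data in `(w, ϖ)` regular on the closed cube at `ϖ₀` (auxiliary variables
      `m ≥ 1` ARE needed: rule (2) along a polynomial isotopy of the cube is an `m = 1` element,
      lead c2, `stub_covInstance` p138395 / `stub_isotopyTwo` p139224);
  (d) hyperoctahedral symmetry elements `h − h∘g`, `g = (σ, S)` (`stub_hyperoctahedral`, p137380);
  (e) products (fibre at `ϖ₀` of a TATE vanishing family of dimension `≤ N + 1`: `Q_j(y,0) ≡ c_j ≠ 0`,
      `Q_j ≠ 0` on `[0,1]^{d_j} × (0,b_j)`, `∫ ≡ 0` on `(0,b_j) ∋ ϖ₀`) × (cofactor)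
      (`stub_glueProduct`, p115064, with the induction hypothesis);
  assembled by `stub_assembly` (p115107).

Why v7 (lead c3) puts the Tate condition BACK (v6 of lead c2 was Tate-free and local in the
parameter): with `Q` allowed `ϖ`-free, v6's `stub_descentLocal N` contains the parameter-free
Kontsevich–Zagier kernel conjecture for ALL rational integrands `p/q` on `[0,1]^{N+2}` with `q ≠ 0` on
the closed cube (e.g. it would have to certify `Li₂(1/2) + (log 2)²/2 − π²/12 = 0`,
`∫∫_{□} [1/(2−z₁z₂) + 1/(2(1+z₁)(1+z₂)) − (4/3)/((1+z₁²)(1+z₂²))] = 0`, by rational relA data) — no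
monodromy/Landau strategy can exist for that, and the crux never asks for it: a Tate `Q` that is
`ϖ`-free is constant (every irreducible factor of a Tate `Q` is constant at `ϖ = 0`, so every polar
component degenerates to infinity as `ϖ → 0`). The parameter locality of v6 is not needed either:
a wall `c(ϖ₁) = 0`, `ϖ₁ ∈ (0, ϖ₀]`, of `ℚ(ϖ)`-rational certificate data is absorbed by clearing the
scalar `c(ϖ)^M` (the boundary family of `c^M · data` is again Tate, admissible and vanishing on
`(0,b)`) and, when `c(ϖ₀) = 0` of order `μ`, by passing to the `μ`-th `ϖ`-derivative of the cleared
identity (`∂_ϖ` commutes with `relA_i` and with face restriction; `∂^μ(c^M F)(ϖ₀) = (c^M)^{(μ)}(ϖ₀)·F(ϖ₀)`),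
see the constructor stubs `stub_descentOfExact` / `stub_descentOfExactWall` (provable, registered,
not used by the composition). So v7's research stub is exactly "the crux in dimension `N + 2`, in
certificate form, given the crux in dimensions `≤ N + 1`" and nothing more.

History: v3.3 (c1): kinds (a)/(d)/(e) at the fibre with Tate `(0,ε_j)` lower families; v4/v5 (c2):
family-level trichotomy with `m = 0` exact part — REFUTED as a normal form
(`evidence-trichotomy-m0-refuted.md`); v6 (c2): v3.3's format made local and Tate-free (12 glue /
instance stubs LANDED: p137354 p137380 p137539 p137587 p137592 p138040 p138064 p138200 p138395
p139224 p139362 p139522); v7 (c3): Tate restored, `(0,b)` intervals, wall constructors.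
-/
noncomputable section

open MeasureTheory Set MvPolynomial
open Literature.NumberTheory.Transcendental
open Literature.ModelTheory.ExponentialFields (IsSemialgebraic)

namespace Summit.KontsevichZagierPeriods.InverseLandau.TateFamilyKernel.Descent

/-! ## The research stub: the Tate descent normal form at the fibre, dimensions `≥ 2` -/

/-- STUB (RESEARCH — Tate descent normal form, dimension `N + 2`). For `ℚ`-polynomials `P, Q` in
`N + 2` cube variables and a parameter `ϖ` with `Q` TATE (`Q(z,0) ≡ c₀ ≠ 0`), `Q ≠ 0` on
`[0,1]^{N+2} × (0,b)`, identically vanishing open-cube integrals on `(0,b)` and a real-algebraic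
`ϖ₀ ∈ (0,b)`, there are `m` auxiliary cube variables and finitely many terms of three kinds —
(a) Ayoub elements with rational data `A_k/D_k` along coordinates `i_k` of `[0,1]^{N+2+m}`,
`D_k(·,ϖ₀) ≠ 0` on the closed cube; (d) hyperoctahedral symmetry elements `h_l − h_l ∘ g_l`,
`g_l = (σ_l, S_l)`, `h_l = B_l/E_l` with `E_l(·,ϖ₀) ≠ 0` on the cube; (e) products
`(P_j/Q_j)(w ∘ e_j ∘ castAdd, ϖ₀) · (B_j/E_j)(w ∘ e_j ∘ natAdd, ϖ₀)` where `P_j/Q_j` is a TATE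
vanishing family of dimension `d_j ≤ N + 1` (`Q_j(y,0) ≡ c_j ≠ 0`, `Q_j ≠ 0` on
`[0,1]^{d_j} × (0,b_j)`, open-cube integrals `≡ 0` on `(0,b_j) ∋ ϖ₀`), `e_j` a placement and
`E_j(·,ϖ₀) ≠ 0` on `[0,1]^{c_j}` — whose sum is the lifted fibre `P/Q(w₁,…,w_{N+2}, ϖ₀)` at every
point of the closed cube `[0,1]^{N+2+m}`. This is exactly the crux in dimension `N + 2`, in
certificate form, given the crux in dimensions `≤ N + 1` (`tameFibreKernel_tate_all`).
(Conjectural — for rational Tate families it contains Ayoub's open Remarque 1.17. Why this shape: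
kind (a) WITH auxiliary variables contains the Griffiths-exact part (`m = 0`, with walls: `stub_exactWall`
p145504), closed loops (`m = 1`, `DlogLoopRelator`) and all TRANSPORT elements of face-to-coordinate-line
polynomial families (`m = 1`: `stub_isotopyTwo` p139224, `stub_isotopyThree` p143267; classes fold p142581 /
p144173, jac p143238, cov/loop instances); kind (d) is the discrete part of rule (2) for self-maps of the cube;
kind (e) carries the lower-dimensional transcendence (Baker in dimension 1) through the induction
and absorbs the walls of `ℚ(ϖ)`-rational certificate data (scalar `c(ϖ)^M` cleared, `ϖ`-derivative
families `stub_derivFamily`). Why TATE and `(0,b)` (lead c3): without the Tate condition the stub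
would contain the parameter-free Kontsevich–Zagier kernel conjecture on `[0,1]^{N+2}` (`Q` `ϖ`-free),
which the crux never needs. Evidence: leads' census — c1/c2: ~600 vanishing elements of ~40 Tate
families = exact + odd + isotopy + loop ⊗ cofactor, each mechanism with a landed Lean instance; first
infinite classes: `stub_indepClass` (p139362) and the linear class `linClass_mem_relations` below.)
[cite: AyoubRelKZRevisited, Théorème 1.7 and Remarque 1.17] [cite: KontsevichZagier2001, §1.2] -/
theorem stub_descentTate (N : ℕ) :
    ∀ (P Q : MvPolynomial (Fin (N + 2 + 1)) ℚ) (b : ℝ),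
      (∃ c₀ : ℚ, c₀ ≠ 0 ∧ ∀ z : Fin (N + 2) → ℝ,
        aeval (Fin.snoc z (0 : ℝ) : Fin (N + 2 + 1) → ℝ) Q = (c₀ : ℝ)) →
      (∀ (z : Fin (N + 2) → ℝ) (ϖ : ℝ), (∀ t, z t ∈ Icc (0 : ℝ) 1) → ϖ ∈ Ioo 0 b →
        aeval (Fin.snoc z ϖ : Fin (N + 2 + 1) → ℝ) Q ≠ 0) →
      (∀ ϖ ∈ Ioo 0 b, ∫ z in Set.pi Set.univ (fun _ : Fin (N + 2) => Ioo (0 : ℝ) 1),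
        aeval (Fin.snoc z ϖ : Fin (N + 2 + 1) → ℝ) P / aeval (Fin.snoc z ϖ : Fin (N + 2 + 1) → ℝ) Q = 0) →
      ∀ ϖ₀ : ℝ, IsAlgebraic ℚ ϖ₀ → ϖ₀ ∈ Ioo 0 b →
      ∃ (m K : ℕ) (A Dn : Fin K → MvPolynomial (Fin (N + 2 + m + 1)) ℚ) (i : Fin K → Fin (N + 2 + m))
        (L : ℕ) (B E : Fin L → MvPolynomial (Fin (N + 2 + m + 1)) ℚ)
        (σ : Fin L → Equiv.Perm (Fin (N + 2 + m))) (S : Fin L → Finset (Fin (N + 2 + m)))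
        (J : ℕ) (d c : Fin J → ℕ) (e : ∀ j, Fin (d j + c j) ≃ Fin (N + 2 + m))
        (Pj Qj : ∀ j, MvPolynomial (Fin (d j + 1)) ℚ) (bj : Fin J → ℝ)
        (Bj Ej : ∀ j, MvPolynomial (Fin (c j + 1)) ℚ),
        (∀ k, ∀ w ∈ KZ.cube (N + 2 + m), aeval (Fin.snoc w ϖ₀ : Fin (N + 2 + m + 1) → ℝ) (Dn k) ≠ 0) ∧
        (∀ l, ∀ w ∈ KZ.cube (N + 2 + m), aeval (Fin.snoc w ϖ₀ : Fin (N + 2 + m + 1) → ℝ) (E l) ≠ 0) ∧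
        (∀ j, d j ≤ N + 1) ∧
        (∀ j, ∃ c₀ : ℚ, c₀ ≠ 0 ∧ ∀ y : Fin (d j) → ℝ,
          aeval (Fin.snoc y (0 : ℝ) : Fin (d j + 1) → ℝ) (Qj j) = (c₀ : ℝ)) ∧
        (∀ j (y : Fin (d j) → ℝ) (ϖ : ℝ), (∀ t, y t ∈ Icc (0 : ℝ) 1) → ϖ ∈ Ioo 0 (bj j) →
          aeval (Fin.snoc y ϖ : Fin (d j + 1) → ℝ) (Qj j) ≠ 0) ∧
        (∀ j, ∀ ϖ ∈ Ioo 0 (bj j), ∫ y in Set.pi Set.univ (fun _ : Fin (d j) => Ioo (0 : ℝ) 1),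
          aeval (Fin.snoc y ϖ : Fin (d j + 1) → ℝ) (Pj j) / aeval (Fin.snoc y ϖ : Fin (d j + 1) → ℝ) (Qj j) = 0) ∧
        (∀ j, ϖ₀ ∈ Ioo 0 (bj j)) ∧
        (∀ j, ∀ y ∈ KZ.cube (c j), aeval (Fin.snoc y ϖ₀ : Fin (c j + 1) → ℝ) (Ej j) ≠ 0) ∧
        (∀ w ∈ KZ.cube (N + 2 + m),
          aeval (Fin.snoc (fun t => w (Fin.castAdd m t)) ϖ₀ : Fin (N + 2 + 1) → ℝ) P /
              aeval (Fin.snoc (fun t => w (Fin.castAdd m t)) ϖ₀ : Fin (N + 2 + 1) → ℝ) Q =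
            (∑ k : Fin K,
              (aeval (Fin.snoc w ϖ₀ : Fin (N + 2 + m + 1) → ℝ)
                  (pderiv (Fin.castSucc (i k)) (A k) * Dn k - A k * pderiv (Fin.castSucc (i k)) (Dn k)) /
                aeval (Fin.snoc w ϖ₀ : Fin (N + 2 + m + 1) → ℝ) (Dn k ^ 2)
              - aeval (Fin.snoc (Function.update w (i k) 1) ϖ₀ : Fin (N + 2 + m + 1) → ℝ) (A k) /
                  aeval (Fin.snoc (Function.update w (i k) 1) ϖ₀ : Fin (N + 2 + m + 1) → ℝ) (Dn k)
              + aeval (Fin.snoc (Function.update w (i k) 0) ϖ₀ : Fin (N + 2 + m + 1) → ℝ) (A k) /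
                  aeval (Fin.snoc (Function.update w (i k) 0) ϖ₀ : Fin (N + 2 + m + 1) → ℝ) (Dn k))) +
            (∑ l : Fin L,
              (aeval (Fin.snoc w ϖ₀ : Fin (N + 2 + m + 1) → ℝ) (B l) /
                  aeval (Fin.snoc w ϖ₀ : Fin (N + 2 + m + 1) → ℝ) (E l) -
                aeval (Fin.snoc (fun t => if t ∈ S l then 1 - w (σ l t) else w (σ l t)) ϖ₀ :
                    Fin (N + 2 + m + 1) → ℝ) (B l) /
                  aeval (Fin.snoc (fun t => if t ∈ S l then 1 - w (σ l t) else w (σ l t)) ϖ₀ :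
                    Fin (N + 2 + m + 1) → ℝ) (E l))) +
            (∑ j : Fin J,
              aeval (Fin.snoc (fun t => w (e j (Fin.castAdd (c j) t))) ϖ₀ : Fin (d j + 1) → ℝ) (Pj j) /
                  aeval (Fin.snoc (fun t => w (e j (Fin.castAdd (c j) t))) ϖ₀ : Fin (d j + 1) → ℝ) (Qj j) *
                (aeval (Fin.snoc (fun t => w (e j (Fin.natAdd (d j) t))) ϖ₀ : Fin (c j + 1) → ℝ) (Bj j) /
                  aeval (Fin.snoc (fun t => w (e j (Fin.natAdd (d j) t))) ϖ₀ : Fin (c j + 1) → ℝ) (Ej j)))) := by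
  sorry

/-! ## Provable stubs (registered; tools of the line, not used by the composition `TateFamilyKernel_of`) -/

/-! ### LANDED (lead c3, p142581): `stub_foldClass` — the FOLD CLASS (dimension 2, kind (a) with ONE
auxiliary variable, via `stub_isotopyTwo`) + the census instance `foldInstance_mem_relations`
(Theorems/InverseLandauTateFamilyKernelStubFoldClass.lean). For `c ∈ ℚ[w₀,w₁,ϖ]` vanishing on both `w₁`-faces
and `h = B/E` regular along `{(w₀, s·c(w,ϖ₀))}`, every tame representation of `h(w₀, c, ϖ₀)·∂₁c` is a relation. -/

/-! ### LANDED (lead c3): `stub_jacClass` (p143238, …StubJacClass.lean — torus pull-back `h(Q₁,Q₂)·Jac(Q₁,Q₂)`,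
dimension 2, via `stub_isotopyTwo`) and `stub_isotopyThree` (p143267, …StubIsotopyThree.lean — the dimension-3
transport certificate: Piola identity split as Jacobi + Cramer, `tame_certificate (n := 3) (m := 1)`). -/

/-! ### LANDED (lead c3, p144173): `stub_foldClass3` — the dimension-3 fold class via `stub_isotopyThree`
(Theorems/InverseLandauTateFamilyKernelStubFoldClass3.lean). -/

/-! ### LANDED (lead c3, p145504): `stub_exactWall` — WALL ABSORPTION for family-level Griffiths data
(Theorems/InverseLandauTateFamilyKernelStubExactWall.lean): family identity `c(ϖ)·P/Q = Σ∂_{i_k}(A_k/D_k)` on (0,ε)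
⇒ at EVERY algebraic ϖ₀ (walls included) the hypotheses of `stub_exactDescent` (fibre exactness + Tate boundary family
on (0,ε) with vanishing integrals). Glue `exactFamily_mem_relations` (stub_exactWall + stub_exactDescent + IH) is in the
lead's work/wall_block.lean, to be landed with the next glue file. The exact mechanism of the normal form is thereby
completely formal in v7's (0,b) format. -/

/-! ### LANDED (lead c3): symmetric-fold chain steps `stub_sfMoments` (p145539) and `stub_sfDensity` (p145560). -/

/-! ### LANDED (lead c3): constructors of the normal form — `stub_descentOfExact` (p147008, kind (a) `m = 0`: exact families,
via `stub_exactWall`), `descentOfOdd` / `descentOfProduct` (p146903, kinds (d)/(e)). -/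

/-! ### LANDED (lead c3): `stub_descentOfFold2` (p147211, kind (a) `m = 1`: fold transport elements; helper `Fold.descent_certificate`). -/

/-! ### LANDED (lead c3): `stub_descentOfJac2` (p147617) and `stub_descentOfFold3` (p147625) — kind (a) `m = 1` constructors for JAC and
dimension-3 fold transport elements. With p146903/p147008/p147211 every known mechanism inhabits the research stub's ∃-format. -/

/-! ### Wave 9 (lead c3): the GRAPH-PENCIL CLASS `Q = 1 − ϖ·(u(z₂) + β z₁)`, `u ∈ ℚ[s]` positive and strictly
increasing on `[0,1]` of ANY degree, `β ∈ ℚ_{>0}`, numerator `P ∈ ℚ[z₁,z₂]` arbitrary.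

First (M1)-class whose Landau points are NOT rational over `ℚ(ϖ)` (the boundary points `u(s) = 1/ϖ` are algebraic of
degree `deg u`): the elementary method survives because the ELIMINATION step is done by Euclidean division + infinitely
many zeros instead of log-independence. Chain: `stub_gpMoments` (vanishing ⇒ all polynomial test functions of
`T = u(z₂) + βz₁` integrate to zero against `P`) → `stub_gpDensity` (⇒ on the top interval of the pushforward the single-branch
identity `∫_s^1 P((u(s)+β−u(σ))/β, σ) dσ = 0` for all `s` near `1`) → `stub_gpPolyIntegral` (that integral is a polynomial
`H(y,s)`) → `stub_gpDivision` (`H(u(s)+β, s) = 0` on an interval ⇒ `(y − u(s) − β) ∣ H` ⇒ `P = u'(z₂)∂₁M − β∂₂M` for a polynomial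
`M`) → `stub_gpCertificate` (⇒ `P/Q = ∂₁(u'M/Q) − ∂₂(βM/Q)`: Griffiths-exact at family level, scalar `1`, no walls) → glue
`gpClass_mem_relations` (`exactFamily_mem_relations`, N = 0). Variables: `X 0 = z₁`, `X 1 = z₂ = s`, `X 2 = ϖ`. -/

/-! LANDED (wave 9, ALL FIVE): `stub_gpMoments` p148399, `stub_gpDensity` p149184, `stub_gpPolyIntegral` p148570, `stub_gpDivision` p149192,
`stub_gpCertificate` p148555; glue `gpClass_mem_relations` delegated. Wave 10 (ALL FIVE): `stub_gvMoments` p149291, `stub_gvDensity` p150579, `stub_gvPrimitive` p149495, `stub_gvDivision` p151109,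
`stub_gvCertificate` p149488 landed; glue `gvClass_mem_relations` delegated. -/

/-! ### LANDED: `gpClass_mem_relations` (p150918) — THE GRAPH-PENCIL CLASS THEOREM: Q = 1 − ϖ(u(z₂)+βz₁), u ∈ ℚ[s] positive
strictly increasing of ANY degree, β > 0, every numerator P ∈ ℚ[z₁,z₂]; first proved sub-class whose Landau points are not rational
over ℚ(ϖ) (elimination by the factor theorem on the top interval of the pushforward). -/

/-! ### LANDED (lead c3): `stub_logIndepGerms` (p148340) — Ax-based linear independence of logarithms of algebraic germs
over the algebraic germs (tool for regime (E1′): elimination with log arguments moving algebraically). -/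

/-! ### Wave 10 (lead c3): GRAPH PENCILS WITH LINEAR SLOPE `Q = 1 − ϖ·(u(z₂) + (γ + δ z₂) z₁)` — regime (E1)
`u ∈ ℚ[s]`, `v(s) = γ + δs` with `u, v > 0` on `[0,1]`, `u + v` strictly increasing, `δ ≠ 0` (δ = 0 is wave 9). The pushforward
density on the top interval is `∫_{e(y)}^1 P((y−u(σ))/v(σ), σ)/v(σ) dσ`: a RATIONAL integrand in `σ` with its only pole at
`ρ = −γ/δ ∉ [0,1]`, so the single-branch primitive is `Rn(y,s)/v(s)^k + a(y)·log|v(s)|` with `a ∈ ℚ[y]`. Evaluated ALONG THE GRAPH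
`y = (u+v)(s)` the log argument is linear in `s`, and "polynomial × log|linear| = rational on an interval ⇒ polynomial = 0"
(LinResidues-level) eliminates the log; the factor theorem then gives the twisted identity `v^m P = (u' + δz₁)∂₁Ñ − v∂₂Ñ + mδÑ`,
i.e. `P = D_v N`, `N = Ñ/v^m`, `D_v N := (u'+v'z₁)∂₁N − v∂₂N`, whence `P/Q = ∂₁((u'+δz₁)N/Q) − ∂₂(vN/Q)`: Griffiths-exact with
denominator `Q·v^m` (NOT Tate — the glue therefore goes through the fibre-level `stub_exactFibreTwo` + the ϖ-free dimension-1
theorem `algCoeffKernelDimOne`, exactly as the linear class did). -/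

/-! ### LANDED: `gvClass_mem_relations` (p151843) — THE LINEAR-SLOPE GRAPH-PENCIL CLASS THEOREM (regime (E1)):
Q = 1 − ϖ(u(z₂) + (γ+δz₂)z₁); with `gvClass_openCube_mem_relations`. -/

/-! ### Wave 11 (lead c3): GRAPH PENCILS WITH A GENERAL POLYNOMIAL SLOPE `Q = 1 − ϖ·(u(z₂) + v(z₂) z₁)` — completes regime (E1)
`u, v ∈ ℚ[s]`, `u, v > 0` on `[0,1]`, `W := u + v` strictly increasing, `u < W(1)` on `[0,1]`. `stub_gvMoments` / `stub_gvDensity` are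
already landed for a polynomial slope. New: a LOG-FREE elimination. Write the single-branch integrand `f(y,σ) = P((y−u)/v, σ)/v(σ) =
Σ_l y^l f_l(σ)` (`f_l ∈ ℚ(σ)`, poles only at roots of `v`) and `I_l(s) := ∫_s^1 f_l`; the top-interval identity reads
`Σ_l W(s)^l I_l(s) = 0` on an interval where `W' > 0`. Applying the operator `𝒟 := W'(s)⁻¹ d/ds` (which sends `W^l ↦ l W^{l−1}` and
`I_l ↦ −f_l/W'`, rational) `d = deg_y f` times gives a TRIANGULAR system `Σ_l l(l−1)⋯(l−j+1) W^{l−j} I_l = (rational)_j`, whence every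
`I_l` is a rational function; so every `f_l` is the derivative of a rational function, i.e. `f(y,·)` has a rational primitive `Rn(y,σ)/v(σ)^k`
polynomial in `y` (no logarithms survive) — WITHOUT partial fractions, complex roots or log-independence. Then the factor theorem and the
substitution `y ↦ u + v z₁` give the twisted identity `v^m P = (u' + v'z₁)∂₁Ñ − v∂₂Ñ + m v'Ñ` (descended from `ℝ` to `ℚ` coefficients by a
`ℚ`-linear retraction `ℝ → ℚ`, the identity being `ℚ`-linear in `Ñ`), and `P/Q = ∂₁((u'+v'z₁)N/Q) − ∂₂(vN/Q)`, `N = Ñ/v^m`. -/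

/-! LANDED (wave 11, ALL THREE): `stub_gwRationalPrimitive` p152946 (log-free triangular elimination), `stub_gwDivision` p152856,
`stub_gwCertificate` p152041; glue `gwClass_mem_relations` delegated. -/

/-! ### LANDED: `gwClass_mem_relations` (p153767) — GRAPH PENCILS WITH A GENERAL POLYNOMIAL SLOPE: regime (E1) COMPLETE.
All graph pencils T = u(z₂) + v(z₂)z₁ (u, v > 0, u + v increasing, u < (u+v)(1)) are proved sectors of the crux. -/

/-! ### LANDED: `stub_pencilW` (p154224) — META-LEMMA: ϖ-dependent numerators for every Tate-pencil class theorem in dimension 2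
(reversed numerator; scalar ϖ₀^M absorbed into a ϖ-free numerator since `KZ.relations` is an additive subgroup). -/

/-! ### Wave 12 seed (lead c3, adopting the strategist's EULER SECTOR, idea `euler-sector-parametric-curves`): for a pencil
`Q = 1 − ϖT` with `T` weighted-homogeneous (weights `a, b`, degree `d`) the Euler field `X = a z₁∂₁ + b z₂∂₂` satisfies `X·T = dT`, and
for a weighted-homogeneous numerator `P₀` of degree `w` the operator `λ + dθ` (`θ = ϖ∂_ϖ`, `λ = w + a + b`) applied to `P₀/(1−ϖT)`
is a DIVERGENCE `∂₁(a z₁P₀/(1−ϖT)) + ∂₂(b z₂P₀/(1−ϖT))` — the first lemma of the reduction of crux(2) on the Euler sector to the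
parametric dimension-one statement BoxKernelCurvesW (Lines/Sketch.md "Response to STRATEGY-CENSUS"). -/

/-! ### LANDED: `stub_eulerDivergence` (p154462) — wave 12 seed (Euler sector): (λ + dθ)(P₀ g) = div(P₀ g X) in Griffiths form. -/

/-! ### Wave 12 (lead c3, EULER SECTOR adopted from the strategist's card): TAME reduction of the fibre to a weighted face band.
Reparametrising `ϖ = ϖ₀·t^d` makes every weight POLYNOMIAL: with `λ := w + a + b ≥ 1`, `H(z,t) := t^λ·P₀(z)/(1 − ϖ₀t^dT(z))` satisfies
`∂_tH = t^{λ−1}·((λ + dθ)F)(z, ϖ₀t^d)`, `H(·,1) = F(·,ϖ₀)`, `H(·,0) = 0`, so all representations below are TAME CUBES and every step is an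
Ayoub element `relA` of the cubical calculus (KZCubicalCalculus / `stub_exactDescent` machinery). Variables of the 4-variable data:
`X 0, X 1 = z`, `X 2 = t`, `X 3 ↦ ϖ₀` (evaluated by `aeval (Fin.snoc w ϖ₀)`, `w ∈ KZ.cube 3`); of the 3-variable face data: `X 0 = s`, `X 1 = t`,
`X 2 ↦ ϖ₀`. Steps: (A) `stub_eulerAnchor` [□², F(·,ϖ₀)] ≡ [□³, t^{λ−1}((λ+dθ)F)(z,ϖ₀t^d)] (one relA in `t`, Tate anchor: the `t = 0` face
vanishes); (B) `stub_eulerFaces` ≡ [□², t^{λ−1}·j(s,ϖ₀t^d)] with the ONE-variable face family `j(s,ϖ) = aP₀(1,s)/(1−ϖT(1,s)) + bP₀(s,1)/(1−ϖT(s,1))`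
(two relA's in `z₀, z₁` via `stub_eulerDivergence`; the `z_i = 0` faces vanish); (C) `stub_eulerBandExact`: if `j(·,ϖ) = ∂_sE` with `E` rational,
regular, `E(1,ϖ) = E(0,ϖ)`, the band is a relation (one relA in `s`). (C′) (exactness of `j` from `∫₀¹ j ≡ 0` + genericity, via c1's
`InverseLandauRationalCurves_of`) and the glue `qhPencil_mem_relations` follow in the next cycle. -/

/-! LANDED (wave 12, ALL THREE): `stub_eulerAnchor` p155275, `stub_eulerFaces` p155833, `stub_eulerBandExact` p155356 — the fibre of a
quasi-homogeneous pencil ≡ the weighted exact face band, all TAME. -/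

/-! ### LANDED: `qhPencil_mem_relations_of_faceExact` (p156681) — single-weight quasi-homogeneous pencils modulo the exactness of the
face family: the tame Euler reduction (A)+(B)+(C) composed. Remaining for the Euler sector: (C′) from `InverseLandauRationalCurves_of`
and the multi-weight telescoper (work/T1_design.md in the lead folder; Lines/Sketch.md). -/

/-! ### LANDED tools of this line (lead c3): `stub_derivFamily` (p141685, …StubDerivFamily.lean) and the
LINEAR CLASS chain `stub_linMoments` (p141771) → `stub_linDensity` (p142255) → `stub_linResidues` (p142381) →
`stub_linExact` (p141821), composed with `stub_exactFibreTwo` (p138200) into `linClass_mem_relations`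
(file work/stubs/LinClass.lean of the lead, to be landed as Theorems/InverseLandauTateFamilyKernelLinClass.lean
once the farm serves the new oleans): for `Q = 1 − ϖ(α+βz₂)z₁`, `α, β > 0`, `P` `ϖ`-free, every tame fibre at a
real-algebraic `ϖ₀ ∈ (0,b)` is a relation — the research stub PROVED on its first infinite class with a genuinely
two-variable Tate denominator. -/

/-! ### LANDED (lead c3): the linear class with a `ϖ`-DEPENDENT numerator — `stub_linMomentsW` (p143634,
reversed polynomial `P̃ = T^{M₀}P(z,1/T)`) and `stub_linExactW` (p143701); glue `linClassW_mem_relations`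
(work/stubs/LinClassW.lean of the lead: `stub_linMomentsW` → `stub_linDensity`, `stub_linResidues` applied to `P̃` →
`stub_linExactW` → `stub_exactFibreTwo`). -/

/-! ### LANDED (lead c3): the SYMMETRIC-FOLD LINEAR CLASS `Q = 1 − ϖ z₁(1−z₁)(α+βz₂)` — the first class where
kind (d) (the reflection `z₁ ↦ 1−z₁`) is essential: `stub_sfEvenOdd` (p145788), `stub_sfMoments` (p145539),
`stub_sfDensity` (p145560), `stub_sfLogCoeff` (p145741) + `stub_sfLogElim` (p145790 pending), `stub_sfExact` (p145653);
glue `sfClass_mem_relations` in the lead's work/stubs/SfClass.lean (to land when the last part is in). -/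

/-! ## Wave 13 (lead c4): the MULTI-WEIGHT EULER TELESCOPER — every numerator, quasi-homogeneous `T`

For `T` weighted-homogeneous (weights `a, b`, degree `d`) and an ARBITRARY numerator `P = Σ_{w∈W} P_w`
(`P_w` weighted-homogeneous of weight `w`, `λ_w := w + a + b ≥ 1`, distinct), the landed per-weight steps
(A) `stub_eulerAnchor` + (B) `stub_eulerFaces` give `[□², P_w/(1−ϖ₀T)] ≡ [□²_{s,t}, t^{λ_w−1}·ĵ_w]` with the
face families `ĵ_w(s,t) = j_w(s, ϖ₀t^d)`, `j_w(s,ϖ) = aP_w(1,s)/(1−ϖT(1,s)) + bP_w(s,1)/(1−ϖT(s,1))`. The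
individual `∫₀¹ ĵ_w ds` do NOT vanish; what vanishes is the face integral of the TELESCOPED family
`j_L := Σ_w ∏_{v≠w}(λ_v + dθ) j_w` (`θ = ϖ∂_ϖ`; `∫₀¹ j_L ds = (∏_v(λ_v + dθ)) I(ϖ) ≡ 0`, `stub_qhFaceMoments`).
KEY IDENTITY (lead c4, `stub_eulerTower`): with `δ = t∂_t` (`= dθ` along `ϖ = ϖ₀t^d`), `c_u := ∏_{v≠u}(λ_v − λ_u)`,
`ε(t) := Σ_u t^{λ_u−1}/c_u` and the Euler-operator rule `t^m·(λ + δ)h = (λ − m − 1)t^m h + ∂_t(t^{m+1}h)`: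
  `Σ_w t^{λ_w−1} ĵ_w = ε(t)·ĵ_L − ∂_t K`,  `K := Σ_u (t^{λ_u}/c_u) Σ_w q_{u,w}(δ) ĵ_w`, `q_{u,w} := (e_w − e_w(−λ_u))/(X + λ_u)`,
  `e_w := ∏_{v≠w}(X + λ_v)`, and `K|_{t=0} = 0` (`λ_u ≥ 1`), `K|_{t=1} = 0` (Lagrange interpolation: `Σ_u q_{u,w}/c_u = 0`).
Hence, given a rational/semialgebraic `s`-primitive `E` of `ĵ_L` with equal endpoint values ((C′) for ONE explicit
one-variable family), `Σ_w t^{λ_w−1}ĵ_w = relA_s(εE) − relA_t(K)` is a sum of two Ayoub elements on the SAME square: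
`stub_eulerBandMulti`; glue `qhPencilMulti_mem_relations_of_faceExact`. No higher-dimensional boxes, no Baker.
The `δ`-tower of `ĵ_w` is carried as explicit polynomial data `M w i / Dab^{i+1}` (`M w (i+1) = X₁(∂₁(M w i)·Dab −
(i+1)·M w i·∂₁Dab)`), variables `X 0 = s`, `X 1 = t`, `X 2 ↦ ϖ₀`. -/

/-! ### LANDED (lead c4, p159430): `stub_eulerTower` — the Euler tower identity (Theorems/InverseLandauTateFamilyKernelStubEulerTower.lean). -/

/-! ### LANDED (wave 13, p160386): `stub_eulerBandMulti` — the multi-weight exact face band (…StubEulerBandMulti.lean; abstract form `EulerBandMulti.band_mem_relations`). -/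

/-! ### LANDED (p160779): `qhPencilMulti_mem_relations_of_faceExact` — Theorems/InverseLandauTateFamilyKernelQhPencilMulti.lean. -/

/-! ### LANDED (wave 13, p159103): `stub_pencilMoments` — moments of a vanishing pencil (…StubPencilMoments.lean). -/

/-! ### LANDED (wave 13, p159502): `stub_qhFaceMoments` — face moments of the telescoped family vanish (…StubQhFaceMoments.lean; helper `QhFaceMoments.euler_moment`). -/

/-! ### LANDED (wave 13, p160047): `stub_towerBind` — the θ-tower at the (s,ϖ)-level becomes the δ-tower of `stub_eulerBandMulti` under `ϖ = ϖ₀t^d` (…StubTowerBind.lean; helper `TowerBind.pderiv_bind₁` = chain rule for `bind₁`). -/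

/-! ## Wave 14 (lead c4): (C′) made ELEMENTARY for MONOTONE faces — Hermite reduction in `s` over `ℚ(ϖ)`,
the difference quotient `Ã(s,ϖ) ↦ Ã(s,1/τ(s))`, "a RATIONAL Stieltjes transform has zero density" (moments +
Weierstrass, two faces separated by their `u`-supports), uniqueness of `τ`-adic digits, and wall removal. See
Lines/Sketch.md §"(C′) made ELEMENTARY". All six stubs are independent, self-contained statements. -/

/-! ### LANDED (p160619): `stub_hermiteReduce` — Theorems/InverseLandauTateFamilyKernelStubHermiteReduce.lean. -/

/-! ### LANDED (p160812): `stub_tateFaceCoprime` — Theorems/InverseLandauTateFamilyKernelStubTateFaceCoprime.lean. -/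

/-! ### LANDED (p161577): `stub_twoFaceDensityZero` — Theorems/InverseLandauTateFamilyKernelStubTwoFaceDensityZero.lean. -/

/-! ### LANDED (p160642): `stub_tauAdicDigits` — Theorems/InverseLandauTateFamilyKernelStubTauAdicDigits.lean. -/

/-! ### LANDED (p161170): `stub_wallRemoval` — Theorems/InverseLandauTateFamilyKernelStubWallRemoval.lean. -/

/-! ### LANDED (p160922): `stub_faceQuotient` — Theorems/InverseLandauTateFamilyKernelStubFaceQuotient.lean. -/

/-! ## Wave 15 (lead c4): assembling (C′) — tower split, face series vanishing, Hermite in MvPolynomial form, digits, densities, primitive, class theorem -/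

/-! ### LANDED (p160913): `stub_towerSplit` — Theorems/InverseLandauTateFamilyKernelStubTowerSplit.lean. -/

/-! ### LANDED (p161173): `stub_digitsMv` — Theorems/InverseLandauTateFamilyKernelStubDigitsMv.lean. -/

/-! ### LANDED (p162440): `stub_faceSeriesVanishing` — Theorems/InverseLandauTateFamilyKernelStubFaceSeriesVanishing.lean. -/

/-! ### LANDED (p162330): `stub_hermiteFaceMv` — Theorems/InverseLandauTateFamilyKernelStubHermiteFaceMv.lean. -/

/-! ### LANDED (p162257): `stub_faceRationalIdentity` — Theorems/InverseLandauTateFamilyKernelStubFaceRationalIdentity.lean. -/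

/-! ### LANDED (p162134): `stub_faceRemaindersVanish` — Theorems/InverseLandauTateFamilyKernelStubFaceRemaindersVanish.lean. -/

/-! ### LANDED (p162217): `stub_primitiveAlgebra` — Theorems/InverseLandauTateFamilyKernelStubPrimitiveAlgebra.lean. -/

/-! ### LANDED (p162540): `stub_primitiveWalls` — Theorems/InverseLandauTateFamilyKernelStubPrimitiveWalls.lean. -/

/-! ### LANDED (p162782): `stub_qhFacesExact` — Theorems/InverseLandauTateFamilyKernelQhFacesExact.lean. -/

/-! ### LANDED (p163351): `stub_qhFaceExactE` — Theorems/InverseLandauTateFamilyKernelQhFaceExactE.lean. -/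

/-! ### LANDED (p163654, lead c4): THE CLASS THEOREM `qhPencilMonotone_mem_relations` + `qhPencilMonotone_openCube_mem_relations` +
`brieskornPham_openCube_mem_relations` — Theorems/InverseLandauTateFamilyKernelQhPencilMonotone.lean. -/

/-! ## Wave 16 (lead c4, seeds for the corner case `T(1,0) = T(0,1)`): transport of the face bands onto a common square -/

/-! ### LANDED (p163802, lead c4): `stub_covMonotoneFirstCoord` — Theorems/InverseLandauTateFamilyKernelStubCovMonotone.lean (rule (2) along a
monotone polynomial in the first coordinate; the transport move for the corner case). -/

/-! ## Glue (proved here) -/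

/-- **Dimension `0`, local form**: the vanishing "integral over `(0,1)⁰`" is the value of the fibre
integrand at the point, so every tame cube representation of the fibre has zero integrand
(cf. `stub_dimZero`, p114697). [cite: KontsevichZagier2001, §1.2] -/
theorem dimZero_local (P Q : MvPolynomial (Fin (0 + 1)) ℚ) (a b : ℝ)
    (hvan : ∀ ϖ ∈ Ioo a b, ∫ z in Set.pi Set.univ (fun _ : Fin 0 => Ioo (0 : ℝ) 1),
      aeval (Fin.snoc z ϖ : Fin (0 + 1) → ℝ) P / aeval (Fin.snoc z ϖ : Fin (0 + 1) → ℝ) Q = 0)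
    (ϖ₀ : ℝ) (hϖ₀ : ϖ₀ ∈ Ioo a b) (Φ : KZ.IntegralRep 0) (hΦ : Φ.IsTameCube)
    (hint : ∀ z ∈ KZ.cube 0, Φ.integrand z =
      aeval (Fin.snoc z ϖ₀ : Fin (0 + 1) → ℝ) P / aeval (Fin.snoc z ϖ₀ : Fin (0 + 1) → ℝ) Q) :
    KZ.of Φ ∈ KZ.relations := by
  have h0 : aeval (Fin.snoc (default : Fin 0 → ℝ) ϖ₀ : Fin (0 + 1) → ℝ) P /
      aeval (Fin.snoc (default : Fin 0 → ℝ) ϖ₀ : Fin (0 + 1) → ℝ) Q = 0 := by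
    have h := hvan ϖ₀ hϖ₀
    rwa [setIntegral_pi_univ_Ioo_fin_zero (fun z : Fin 0 → ℝ =>
      aeval (Fin.snoc z ϖ₀ : Fin (0 + 1) → ℝ) P / aeval (Fin.snoc z ϖ₀ : Fin (0 + 1) → ℝ) Q)] at h
  refine KZ.of_mem_relations_of_eqOn_zero Φ fun z hz => ?_
  rw [hΦ.domain_eq] at hz
  rw [Pi.zero_apply, hint z hz, Subsingleton.elim z default]
  exact h0

/-- **Dimension one, local form**: specialise at the algebraic fibre `ϖ₀` (`p₀ = P(X, ϖ₀)`,
`q₀ = Q(X, ϖ₀) ∈ ℝ[X]` have coefficients in `ℚ(ϖ₀)`, hence real algebraic; `q₀ ≠ 0` on `[0,1]`; the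
vanishing open-cube integral is the interval integral) and apply the transfer `algCoeffKernelDimOne`
(Baker; Theorems/InverseLandauTateFamilyKernelCurves.lean), then pass from the open interval to the tame
cube by the null-faces bridge. (Adapted from `TateFamilyKernelCurves_of`, which carries an unused Tate
hypothesis.) [cite: KontsevichZagier2001, §1.2] [cite: Baker1975, Thm. 2.1] -/
theorem curves_local (P Q : MvPolynomial (Fin (1 + 1)) ℚ) (a b : ℝ)
    (hadm : ∀ (z : Fin 1 → ℝ) (ϖ : ℝ), (∀ i, z i ∈ Icc (0 : ℝ) 1) → ϖ ∈ Ioo a b →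
      aeval (Fin.snoc z ϖ : Fin (1 + 1) → ℝ) Q ≠ 0)
    (hvan : ∀ ϖ ∈ Ioo a b, ∫ z in Set.pi Set.univ (fun _ : Fin 1 => Ioo (0 : ℝ) 1),
      aeval (Fin.snoc z ϖ : Fin (1 + 1) → ℝ) P / aeval (Fin.snoc z ϖ : Fin (1 + 1) → ℝ) Q = 0)
    (ϖ₀ : ℝ) (halg : IsAlgebraic ℚ ϖ₀) (hϖ₀ : ϖ₀ ∈ Ioo a b)
    (Φ : KZ.IntegralRep 1) (hΦ : Φ.IsTameCube)
    (hΦi : ∀ z ∈ KZ.cube 1, Φ.integrand z =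
      aeval (Fin.snoc z ϖ₀ : Fin (1 + 1) → ℝ) P / aeval (Fin.snoc z ϖ₀ : Fin (1 + 1) → ℝ) Q) :
    KZ.of Φ ∈ KZ.relations := by
  classical
  -- the specialisation map `X₀ ↦ X`, `X₁ ↦ ϖ₀` (as in `TateFamilyKernelCurves_of`)
  set f : Fin 2 → Polynomial ℝ := Fin.snoc (fun _ : Fin 1 => Polynomial.X) (Polynomial.C ϖ₀) with hf
  set ev : MvPolynomial (Fin 2) ℚ →ₐ[ℚ] Polynomial ℝ := MvPolynomial.aeval f with hev
  have hev_eval : ∀ (S : MvPolynomial (Fin 2) ℚ) (z : Fin 1 → ℝ),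
      (ev S).eval (z 0) = MvPolynomial.aeval (Fin.snoc z ϖ₀ : Fin 2 → ℝ) S := by
    intro S z
    have h1 : ((Polynomial.aeval (z 0) : Polynomial ℝ →ₐ[ℝ] ℝ).restrictScalars ℚ).comp ev =
        MvPolynomial.aeval (Fin.snoc z ϖ₀ : Fin 2 → ℝ) := by
      rw [hev, MvPolynomial.comp_aeval]
      congr 1
      funext i
      refine Fin.lastCases ?_ (fun i => ?_) i
      · simp only [hf, Fin.snoc_last]
        simp
      · have hi : i = 0 := Subsingleton.elim _ _
        subst hi
        simp only [hf, Fin.snoc_castSucc]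
        simp
    have h2 := congrArg (fun φ : MvPolynomial (Fin 2) ℚ →ₐ[ℚ] ℝ => φ S) h1
    simpa [Polynomial.coe_aeval_eq_eval] using h2
  have hcoef : ∀ S : MvPolynomial (Fin 2) ℚ, ∀ n, IsAlgebraic ℚ ((ev S).coeff n) := by
    intro S
    induction S using MvPolynomial.induction_on with
    | C a =>
      intro n
      rw [hev, MvPolynomial.aeval_C, Polynomial.algebraMap_apply, Polynomial.coeff_C]
      split_ifs
      · exact isAlgebraic_algebraMap _
      · exact isAlgebraic_zero
    | add p q hp hq =>
      intro n
      rw [map_add, Polynomial.coeff_add]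
      exact (hp n).add (hq n)
    | mul_X p i hp =>
      intro n
      rw [map_mul, hev, MvPolynomial.aeval_X]
      refine Fin.lastCases ?_ (fun i => ?_) i
      · have : f (Fin.last 1) = Polynomial.C ϖ₀ := by simp only [hf, Fin.snoc_last]
        rw [this, Polynomial.coeff_mul_C]
        exact (hp n).mul halg
      · have hi : i = 0 := Subsingleton.elim _ _
        subst hi
        have : f (Fin.castSucc 0) = Polynomial.X := by simp only [hf, Fin.snoc_castSucc]
        rw [this]
        cases n with
        | zero =>
          rw [Polynomial.mul_coeff_zero, Polynomial.coeff_X_zero, mul_zero]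
          exact isAlgebraic_zero
        | succ n =>
          rw [Polynomial.coeff_mul_X]
          exact hp n
  -- the fibre data
  have hq0 : ∀ t ∈ Set.Icc (0 : ℝ) 1, (ev Q).eval t ≠ 0 := fun t ht => by
    have := hadm (fun _ : Fin 1 => t) ϖ₀ (fun _ => ht) hϖ₀
    rwa [← hev_eval Q (fun _ : Fin 1 => t)] at this
  have hintv : ∫ t in (0 : ℝ)..1, (ev P).eval t / (ev Q).eval t = 0 := by
    have h0 := hvan ϖ₀ hϖ₀
    rw [pi_univ_Ioo_eq] at h0
    have e2 : (fun z : Fin 1 → ℝ => MvPolynomial.aeval (Fin.snoc z ϖ₀ : Fin 2 → ℝ) P /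
        MvPolynomial.aeval (Fin.snoc z ϖ₀ : Fin 2 → ℝ) Q) =
        fun z => (fun t => (ev P).eval t / (ev Q).eval t) (z 0) := by
      funext z
      simp only [hev_eval]
    rw [e2, setIntegral_fin_one_eq (fun t => (ev P).eval t / (ev Q).eval t) zero_le_one] at h0
    exact h0
  -- the honest open-interval restriction of `Φ`
  have hE : IsSemialgebraic ℚ (openUnitCube 1) := isSemialgebraic_openUnitCube
  have hEsub : openUnitCube 1 ⊆ Φ.domain := by
    rw [hΦ.domain_eq]; exact KZ.openUnitCube_subset_cube
  set r : KZ.IntegralRep 1 := Φ.restrict _ hE hEsub with hr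
  have hrd : r.domain = Set.pi Set.univ (fun _ : Fin 1 => Ioo (0 : ℝ) 1) := by
    rw [pi_univ_Ioo_eq_openUnitCube]; rfl
  have hrd' : r.domain = {x | x 0 ∈ Set.Ioo (0 : ℝ) 1} := by rw [hrd, pi_univ_Ioo_eq]
  have hri : EqOn r.integrand (fun x => (ev P).eval (x 0) / (ev Q).eval (x 0)) r.domain := by
    intro z hz
    have hz' : z ∈ KZ.cube 1 := by
      rw [hrd, pi_univ_Ioo_eq_openUnitCube] at hz
      exact KZ.openUnitCube_subset_cube hz
    show r.integrand z = (ev P).eval (z 0) / (ev Q).eval (z 0)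
    rw [hev_eval, hev_eval]
    simpa [hr] using hΦi z hz'
  have hrrel : KZ.of r ∈ KZ.relations :=
    algCoeffKernelDimOne (ev P) (ev Q) (hcoef P) (hcoef Q) hq0 hintv r hrd' hri
  have hsub : KZ.of Φ - KZ.of r ∈ KZ.relations :=
    of_sub_of_mem_relations_of_domain_eq_cube Φ r hΦ.domain_eq hrd (fun z _ => by simp [hr])
  have : KZ.of Φ = (KZ.of Φ - KZ.of r) + KZ.of r := by abel
  rw [this]
  exact KZ.relations.add_mem hsub hrrel

/-- **The crux in tame-fibre form, every dimension**, by strong induction on the dimension for TATE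
families on `(0,b)`: `0` (`dimZero_local`), `1` (`curves_local`), `N + 2` (Tate descent normal form
`stub_descentTate`, assembled by `stub_assembly` from the Ayoub elements, `stub_hyperoctahedral`,
`stub_glueProduct` and the induction hypothesis in dimensions `≤ N + 1`, applied to the TATE lower
families of kind (e)). -/
theorem tameFibreKernel_tate_all : ∀ D : ℕ,
    ∀ (P Q : MvPolynomial (Fin (D + 1)) ℚ) (b : ℝ),
      (∃ c₀ : ℚ, c₀ ≠ 0 ∧ ∀ z : Fin D → ℝ, aeval (Fin.snoc z (0 : ℝ) : Fin (D + 1) → ℝ) Q = (c₀ : ℝ)) →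
      (∀ (z : Fin D → ℝ) (ϖ : ℝ), (∀ i, z i ∈ Icc (0 : ℝ) 1) → ϖ ∈ Ioo 0 b →
        aeval (Fin.snoc z ϖ : Fin (D + 1) → ℝ) Q ≠ 0) →
      (∀ ϖ ∈ Ioo 0 b, ∫ z in Set.pi Set.univ (fun _ : Fin D => Ioo (0 : ℝ) 1),
        aeval (Fin.snoc z ϖ : Fin (D + 1) → ℝ) P / aeval (Fin.snoc z ϖ : Fin (D + 1) → ℝ) Q = 0) →
      ∀ ϖ₀ : ℝ, IsAlgebraic ℚ ϖ₀ → ϖ₀ ∈ Ioo 0 b →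
      ∀ Φ : KZ.IntegralRep D, Φ.IsTameCube →
        (∀ z ∈ KZ.cube D, Φ.integrand z =
          aeval (Fin.snoc z ϖ₀ : Fin (D + 1) → ℝ) P / aeval (Fin.snoc z ϖ₀ : Fin (D + 1) → ℝ) Q) →
        KZ.of Φ ∈ KZ.relations := by
  intro D
  induction D using Nat.strong_induction_on with
  | _ D IH =>
  match D, IH with
  | 0, _ =>
    intro P Q b _ _ hvan ϖ₀ _ hϖ₀ Φ hΦ hΦi
    exact dimZero_local P Q 0 b hvan ϖ₀ hϖ₀ Φ hΦ hΦi
  | 1, _ =>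
    intro P Q b _ hadm hvan ϖ₀ halg hϖ₀ Φ hΦ hΦi
    exact curves_local P Q 0 b hadm hvan ϖ₀ halg hϖ₀ Φ hΦ hΦi
  | N + 2, IH =>
    intro P Q b hT hadm hvan ϖ₀ halg hϖ₀ Φ hΦ hΦi
    -- closed-cube non-vanishing of `Q(·, ϖ₀)`
    have hQ1 : ∀ z ∈ KZ.cube (N + 2), aeval (Fin.snoc z ϖ₀ : Fin (N + 2 + 1) → ℝ) Q ≠ 0 :=
      fun z hz => hadm z ϖ₀ (fun t => hz t) hϖ₀
    -- the descent data at `ϖ₀`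
    obtain ⟨m, K, A, Dn, i, L, B, E, σ, S, J, d, c, e, Pj, Qj, bj, Bj, Ej,
      hDn, hE, hd, hTj, hadmj, hvanj, hϖ₀j, hEj, hident⟩ :=
      stub_descentTate N P Q b hT hadm hvan ϖ₀ halg hϖ₀
    -- closed-cube non-vanishing of the lower denominators at `ϖ₀`
    have hQj : ∀ j, ∀ y ∈ KZ.cube (d j), aeval (Fin.snoc y ϖ₀ : Fin (d j + 1) → ℝ) (Qj j) ≠ 0 :=
      fun j y hy => hadmj j y ϖ₀ (fun t => hy t) (hϖ₀j j)
    -- the lower fibres are relations (induction hypothesis in dimension `d j ≤ N + 1`)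
    have hlow : ∀ j, ∀ U : KZ.IntegralRep (d j), U.IsTameCube →
        (∀ y ∈ KZ.cube (d j), U.integrand y =
          aeval (Fin.snoc y ϖ₀ : Fin (d j + 1) → ℝ) (Pj j) / aeval (Fin.snoc y ϖ₀ : Fin (d j + 1) → ℝ) (Qj j)) →
        KZ.of U ∈ KZ.relations := fun j =>
      IH (d j) (by have := hd j; omega) (Pj j) (Qj j) (bj j) (hTj j) (hadmj j) (hvanj j) ϖ₀ halg (hϖ₀j j)
    -- the product terms: tame, and every tame representation a relation
    have hprod := fun j => stub_glueProduct (M := N + 2 + m)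
      (analyticOnNhd_slice (Pj j) (Qj j) ϖ₀ (hQj j)) (isSemialgebraicFunOn_slice (Pj j) (Qj j) halg (hQj j))
      (analyticOnNhd_slice (Bj j) (Ej j) ϖ₀ (hEj j)) (isSemialgebraicFunOn_slice (Bj j) (Ej j) halg (hEj j))
      (hlow j) (e j)
    -- the symmetry terms
    have hodd := fun l => stub_hyperoctahedral (σ l) (S l)
      (analyticOnNhd_slice (B l) (E l) ϖ₀ (hE l)) (isSemialgebraicFunOn_slice (B l) (E l) halg (hE l))
    -- the two kinds of extra terms, indexed by one sum type
    let H : (Fin L ⊕ Fin J) → (Fin (N + 2 + m) → ℝ) → ℝ :=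
      Sum.elim
        (fun l w => aeval (Fin.snoc w ϖ₀ : Fin (N + 2 + m + 1) → ℝ) (B l) /
            aeval (Fin.snoc w ϖ₀ : Fin (N + 2 + m + 1) → ℝ) (E l) -
          aeval (Fin.snoc (fun t => if t ∈ S l then 1 - w (σ l t) else w (σ l t)) ϖ₀ :
              Fin (N + 2 + m + 1) → ℝ) (B l) /
            aeval (Fin.snoc (fun t => if t ∈ S l then 1 - w (σ l t) else w (σ l t)) ϖ₀ :
              Fin (N + 2 + m + 1) → ℝ) (E l))
        (fun j w => aeval (Fin.snoc (fun t => w (e j (Fin.castAdd (c j) t))) ϖ₀ : Fin (d j + 1) → ℝ) (Pj j) /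
            aeval (Fin.snoc (fun t => w (e j (Fin.castAdd (c j) t))) ϖ₀ : Fin (d j + 1) → ℝ) (Qj j) *
          (aeval (Fin.snoc (fun t => w (e j (Fin.natAdd (d j) t))) ϖ₀ : Fin (c j + 1) → ℝ) (Bj j) /
            aeval (Fin.snoc (fun t => w (e j (Fin.natAdd (d j) t))) ϖ₀ : Fin (c j + 1) → ℝ) (Ej j)))
    have hHa : ∀ l ∈ (Finset.univ : Finset (Fin L ⊕ Fin J)),
        AnalyticOnNhd ℝ (H l) (KZ.cube (N + 2 + m)) := by
      rintro (l | j) -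
      · exact (hodd l).1
      · exact (hprod j).1
    have hHs : ∀ l ∈ (Finset.univ : Finset (Fin L ⊕ Fin J)),
        IsSemialgebraicFunOn ℚ (KZ.cube (N + 2 + m)) (H l) := by
      rintro (l | j) -
      · exact (hodd l).2.1
      · exact (hprod j).2.1
    have hH : ∀ l ∈ (Finset.univ : Finset (Fin L ⊕ Fin J)),
        ∀ R : KZ.IntegralRep (N + 2 + m), R.IsTameCube →
          (∀ w ∈ KZ.cube (N + 2 + m), R.integrand w = H l w) → KZ.of R ∈ KZ.relations := by
      rintro (l | j) - R hR hRi
      · exact (hodd l).2.2 R hR hRi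
      · exact (hprod j).2.2 R hR hRi
    -- assemble
    refine stub_assembly (m := m) (Finset.univ : Finset (Fin K)) (Finset.univ : Finset (Fin L ⊕ Fin J)) i
      (analyticOnNhd_slice P Q ϖ₀ hQ1) (isSemialgebraicFunOn_slice P Q halg hQ1)
      (G := fun k w => aeval (Fin.snoc w ϖ₀ : Fin (N + 2 + m + 1) → ℝ) (A k) /
        aeval (Fin.snoc w ϖ₀ : Fin (N + 2 + m + 1) → ℝ) (Dn k))
      (G' := fun k w => aeval (Fin.snoc w ϖ₀ : Fin (N + 2 + m + 1) → ℝ)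
          (pderiv (Fin.castSucc (i k)) (A k) * Dn k - A k * pderiv (Fin.castSucc (i k)) (Dn k)) /
        aeval (Fin.snoc w ϖ₀ : Fin (N + 2 + m + 1) → ℝ) (Dn k ^ 2))
      (fun k _ => analyticOnNhd_slice (A k) (Dn k) ϖ₀ (hDn k))
      (fun k _ => isSemialgebraicFunOn_slice (A k) (Dn k) halg (hDn k))
      (fun k _ => analyticOnNhd_slice _ _ ϖ₀ fun w hw => ?_)
      (fun k _ => isSemialgebraicFunOn_slice _ _ halg fun w hw => ?_)
      (fun k _ w hw => hasDerivAt_slice_update (A k) (Dn k) ϖ₀ (i k) w (hDn k w hw))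
      (H := H) hHa hHs hH (fun w hw => ?_) Φ hΦ hΦi
    · rw [map_pow]; exact pow_ne_zero 2 (hDn k w hw)
    · rw [map_pow]; exact pow_ne_zero 2 (hDn k w hw)
    · rw [hident w hw, Fintype.sum_sum_type]
      simp only [H, Sum.elim_inl, Sum.elim_inr]
      ring

/-- **The crux from the stubs.** `TateFamilyKernel` is the case `b = ε` of
`tameFibreKernel_tate_all`: the tame fibre exists (`exists_isTameCube_fibre`, closed-cube
non-vanishing from admissibility at `ϖ₀`) and the tame fibre being a relation gives the crux's
open-cube representation (`of_mem_relations_of_isTameCube`). -/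
theorem TateFamilyKernel_of :
    Summit.KontsevichZagierPeriods.KontsevichZagierPeriods.Theses.InverseLandau.TateFamilyKernel := by
  intro n P Q ε _hε hT hadm hvan ϖ₀ halg hϖ₀ r hd hi
  have hQ1 : ∀ z ∈ KZ.cube n, MvPolynomial.aeval (Fin.snoc z ϖ₀ : Fin (n + 1) → ℝ) Q ≠ 0 :=
    fun z hz => hadm z ϖ₀ (fun t => hz t) hϖ₀
  obtain ⟨Φ, hΦ, hΦi⟩ := exists_isTameCube_fibre P Q halg hQ1
  have hΦrel : KZ.of Φ ∈ KZ.relations :=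
    tameFibreKernel_tate_all n P Q ε hT hadm hvan ϖ₀ halg hϖ₀ Φ hΦ (fun z _ => by rw [hΦi])
  exact of_mem_relations_of_isTameCube hΦ hΦrel r hd (fun z hz => by rw [hΦi]; exact hi hz)

end Summit.KontsevichZagierPeriods.InverseLandau.TateFamilyKernel.Descent
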